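/-
BALABAN–IMBRIE–JAFFE 1988 (CMP 114), §5.13 p.305–306 [PDF 49–50], display (5.13.3), AS PRINTED — the INTEGRATED equation
(p.306, read on the page image `lit-balaban-r16/renders/cmp114/original-p050-x2.png`; the held text layer p0050 L8–10 is
garbled):

  «Thus letting 𝒫(Γ) denote the partitions of Γ, we have
     ⟨ Π_{i∈I} f(□_i) ⟩_1 = Σ_{Γ⊂I} ∫ ds_Γ Σ_{π∈𝒫(Γ)} ⟨ Π_{α∈π} [ Σ_{ω(α)} ⟨ δ/δΦ, C_s □_{i₁} Δ □_{i₂} C_s □_{i₃} Δ □_{i₄}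
         … Δ □_{i_{|ω(α)|}} C_s ( ½ δ/δΦ + ℱ ) ⟩ ] Π_{i∈I} f(□_i) ⟩_{s_Γ} .                                      (5.13.3)»

and p.306: «Here s = {s_i : □_i ⊂ X}, and ⟨·⟩_{s_Γ,X} is defined by integrating over the fields in X only.»

THE SEAM (clause C2 of row C2.Eq5.13.3-5.13.4) AND THE COMPOSED ONE-EQUATION FORM.  Two formalizations of
`∂/∂s_Γ ⟨·⟩_{s_Γ,X}` exist in the tree:

  * p25's HONEST ITERATED FRÉCHET PARTIALS `BIJ88PolymerRep5134DerivGauss.Dexp L X Γ` of the region expectation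
    `BIJ88PolymerRep5134Gauss.expect X` (fields on the sites of `X` only), the integrand of the p.305 FTC display
    `BIJ88PolymerRep5134DerivGauss.ftc_expansion_gauss`;
  * p13's URSELL FAMILY `BIJ88CumulantAllOrders5133.dexp Γ` of the all-fields expectation `BIJ88PairingDisplay305.expect`,
    whose walk/train form at every order is `BIJ88WalkForm5133.dexp_eq_sum_trains`.

This file identifies them: the region expectation of `X` IS the all-fields expectation of the X-INSTANCE of the §5.13
Gaussian (sites `Site blk X`, cubes `x ↦ blk x`, coupling the `X`-block `Δ|_X = Δ.submatrix val val`, source `src X`,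
observable `obs X`) —
`expect_region_eq` — and on the closed cube `[0,1]^I` the two derivative families coincide — `Dexp_eq_dexp` — because
both satisfy the FTC recursion `d/du|_{u=s_k} D_Γ(s[k↦u]) = D_{Γ∪k}(s)` from the same order-zero function
(`hasDerivAt_Dexp`, `hasDerivAt_dexp`) and a derivative WITHIN `Icc 0 1` is unique (`uniqueDiffOn_Icc`).  Composing with
`ftc_expansion_gauss` and `dexp_eq_sum_trains` gives the literal integrated (5.13.3) for the Gaussian expectations of a
region, `expect_one_eq_expansionSum_trains`, in the corrected form of G-C2-24 (vertices = blocks of a set partition `σ`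
of `Γ` into singletons and pairs; the print keeps the pairs):

  `⟨Π_{□_i⊂X} f(□_i)⟩_{1,X} = Σ_{Γ⊂I} ∫ds_Γ Σ_{σ∈smallParts Γ} (−1)^{|σ|} Σ_{P∈setPartitions σ} ⟨ (Π_{c∈P} 𝕋_c) Π_{□_i⊂X} f(□_i) ⟩_{s_Γ,X}`,

`𝕋_c = ∂_{C_s𝔫(c)ℱ} + ½ Σ_{pq} (C_s𝔫(c))_{pq} ∂_p∂_q` the train operator of the group `c` (`BIJ88TrainPieces306.trainOp`,
`BIJ88WalkForm5133.trains`), `Σ_Γ ∫ds_Γ` p02's `BIJ88FTCExpansion305.expansionSum` at base point `0`.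

EDITORIAL.  The print's `Π_{α∈π}` over a partition `π` of `Γ` is rendered, as in `BIJ88WalkForm5133`, by the pair
(`σ` = vertex structure, `P` = grouping of the vertices into trains); hypotheses are exactly those of the two inputs
(`Δ ≻ 0` with form bounds `c ≤ Δ ≤ C`, bounded measurable factors `f(□_i)` — cube-locality is not needed here —, a
smooth class `𝒞` on the fields of `X` containing `obs X`, a base colouring `z₀ : Finset I → Site blk X`, which exists as
soon as `X` has a site).  Tree sign `Δ = −Δ_print`.

statement-level skeleton of published theorems with citation tags; proofs where landed; nothing here is a claim
about the Yang–Mills mass gap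

PDF held: `paper:balaban1988-cmp114-bij-abelian-higgs-effective-action` (journal page = PDF page + 256).

CITATION HEADER (lean-in-tree rule).  lit-balaban cell (HOME `run/shared/lean/pub/lit-balaban/`), Phase 2, seat p13
gen 14; row **C2.Eq5.13.3-5.13.4** of `HOME/lit-balaban-r16/ROWS-C2-part2.md` (owner r16, referee ref-5), clause C2 of
the v2.148 flip record («`Dexp = dexp` on the cube not yet a tree lemma, S-sized»).  USED BY NAME, nothing restated:
p25 g8 `BIJ88PolymerRep5134DerivGauss.{Dexp, Dexp_empty, hasDerivAt_Dexp, ftc_expansion_gauss, expansionSum_congr_cube,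
obs_measurable, obs_bdd}`, p25 `BIJ88PolymerRep5134Gauss.{Site, obs, prec, src, expect}`, p13 `BIJ88CumulantAllOrders5133.
{dexp, dexp_empty, hasDerivAt_dexp}`, `BIJ88WalkForm5133.{trains, dexp_eq_sum_trains}`, p02 `BIJ88DirichletForms305.
interpForm_apply`, `BIJ88FTCExpansion305.expansionSum`.

## Main statements (v1.1 = v1.0 + §5, the `C_b^∞` corollary; v1.0 declarations byte-identical)

* `interpForm_X` (`Δ_s` of the X-instance — sites `Site blk X`, cubes `x ↦ blk x`, coupling
  `Δ.submatrix val val` — is the `X`-block `prec X s` of `Δ_s`), `posDef_ΔX`, `formLower_ΔX`,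
  `formUpper_ΔX` (form bounds pass to the block); `sum_eq_sum_site`, `dotProduct_ext`, `quadForm_ext` (extension by zero).
* `expect_region_eq` — **matching the two set-ups**: `⟨·⟩_{s,X}` = the all-fields expectation of the X-instance.
* `Dexp_eq_dexp` — **THE SEAM (clause C2)**: `Dexp L X Γ s = dexp Γ s` (X-instance, `H = obs X`) for `s ∈ [0,1]^I`, `Γ ⊆ L`.
* `expect_one_eq_expansionSum_trains` — **(5.13.3) as printed (integrated), corrected form, for the region expectations.**
* `expect_one_eq_expansionSum_trains_of_cbInf` (v1.1) — **the same with the CONCRETE smooth class `C_b^∞`**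
  (`BIJ88SmoothFactors5133.CbInf`, clause C3): hypotheses `Δ ≻ 0` with form bounds, every `f(□_i) ∈ C_b^∞`, `X` has a site.

## References

* [BalabanImbrieJaffe1988] T. Bałaban, J. Imbrie, A. Jaffe, *Effective action and cluster properties of the abelian
  Higgs model*, Comm. Math. Phys. 114 (1988) 257–315, §5.13 p.305–306.
-/
import Literature.MathematicalPhysics.QuantumFieldTheory.BalabanImbrieJaffe1984to88.BIJ88WalkForm5133
import Literature.MathematicalPhysics.QuantumFieldTheory.BalabanImbrieJaffe1984to88.BIJ88PolymerRep5134DerivGauss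
import Literature.MathematicalPhysics.QuantumFieldTheory.BalabanImbrieJaffe1984to88.BIJ88SmoothFactors5133

noncomputable section

namespace Literature.MathematicalPhysics.QuantumFieldTheory.BalabanImbrieJaffe1984to88.BIJ88WalkFormIntegrated5133

open MeasureTheory Finset Matrix Function Set
open scoped BigOperators Topology
open Literature.Probability.LatticeModels (setPartitions)
open Literature.MathematicalPhysics.QuantumFieldTheory.Balaban1983to89
open B2Eq228Conditioning (weight source)
open BIJ88DirichletForms305 (interpForm interpForm_apply)
open BIJ88FTCExpansion305 (expansionSum)
open BIJ88SDerivative305 (update_mem_cube)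
open BIJ88PairingAllOrders5133 (smallParts)
open BIJ88CumulantAllOrders5133 (dexp dexp_empty hasDerivAt_dexp)
open BIJ88TruncationConnected306 (gexp)
open BIJ88TruncationConnected5133 (bmat)
open BIJ88WalkForm5133 (trains dexp_eq_sum_trains)
open BIJ88PolymerRep5134Gauss (obs prec src)
open BIJ88PolymerRep5134DerivGauss (Dexp Dexp_empty hasDerivAt_Dexp ftc_expansion_gauss expansionSum_congr_cube
  obs_measurable obs_bdd)
open BIJ88SmoothFactors5133 (CbInf)

variable {α I : Type} [Fintype α] [DecidableEq α] [Fintype I] [DecidableEq I]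
  (blk : α → I) (Δ : Matrix α α ℝ) (ℱ : α → ℝ) (f : I → (α → ℝ) → ℝ)

/-! ## §1  The X-instance of the §5.13 Gaussian -/

/-- `Δ_s` of the X-instance (sites `Site blk X`, cubes `x ↦ blk x`, coupling `Δ.submatrix val val`) is the `X`-block
`prec X s` of `Δ_s`: the interpolation (p.305 «Δ_s = Π_{i∈I}[(1 − s_i)a_i + s_i]Δ») commutes with the restriction to the
sites of `X`. [cite: BalabanImbrieJaffe1988, §5.13 p.305] -/
theorem interpForm_X (X : Finset I) (s : I → ℝ) :
    interpForm (fun x : BIJ88PolymerRep5134Gauss.Site blk X => blk x.1) (Δ.submatrix Subtype.val Subtype.val) s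
      = prec blk Δ X s := by
  ext x y
  simp only [prec, submatrix_apply, interpForm_apply]

omit [DecidableEq α] [Fintype I] in
/-- a sum over all sites of a function vanishing off the sites of `X` is the sum over the sites of `X`.
[cite: BalabanImbrieJaffe1988, §5.13 p.306] -/
theorem sum_eq_sum_site (X : Finset I) (F : α → ℝ) (hF : ∀ x, blk x ∉ X → F x = 0) :
    ∑ x, F x = ∑ a : BIJ88PolymerRep5134Gauss.Site blk X, F a.1 := by
  rw [← Fintype.sum_subtype_add_sum_subtype (fun x => blk x ∈ X) F]
  have h0 : ∑ a : {x // ¬ blk x ∈ X}, F a = 0 := Finset.sum_eq_zero fun a _ => hF a.1 a.2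
  rw [h0, add_zero]

omit [DecidableEq α] [Fintype I] in
/-- extension by zero preserves the dot product. [cite: BalabanImbrieJaffe1988, §5.13 p.306] -/
theorem dotProduct_ext (X : Finset I) (v w : BIJ88PolymerRep5134Gauss.Site blk X → ℝ) :
    BIJ88PolymerRep5134Gauss.ext blk X v ⬝ᵥ BIJ88PolymerRep5134Gauss.ext blk X w = v ⬝ᵥ w := by
  unfold dotProduct
  rw [sum_eq_sum_site blk X _ fun x hx => by simp [BIJ88PolymerRep5134Gauss.ext, hx]]
  exact Finset.sum_congr rfl fun a _ => by simp [BIJ88PolymerRep5134Gauss.ext, a.2]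

omit [DecidableEq α] [Fintype I] in
/-- the quadratic form of `Δ` at a field extended by zero from `X` is the quadratic form of the `X`-block.
[cite: BalabanImbrieJaffe1988, §5.13 p.306] -/
theorem quadForm_ext (X : Finset I) (v : BIJ88PolymerRep5134Gauss.Site blk X → ℝ) :
    BIJ88PolymerRep5134Gauss.ext blk X v ⬝ᵥ (Δ *ᵥ BIJ88PolymerRep5134Gauss.ext blk X v)
      = v ⬝ᵥ (Δ.submatrix Subtype.val Subtype.val *ᵥ v) := by
  have hin : ∀ x, (Δ *ᵥ BIJ88PolymerRep5134Gauss.ext blk X v) x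
      = ∑ b : BIJ88PolymerRep5134Gauss.Site blk X, Δ x b.1 * v b := by
    intro x
    simp only [mulVec, dotProduct]
    rw [sum_eq_sum_site blk X _ fun y hy => by simp [BIJ88PolymerRep5134Gauss.ext, hy]]
    exact Finset.sum_congr rfl fun b _ => by simp [BIJ88PolymerRep5134Gauss.ext, b.2]
  unfold dotProduct
  simp_rw [hin]
  rw [sum_eq_sum_site blk X _ fun x hx => by simp [BIJ88PolymerRep5134Gauss.ext, hx]]
  refine Finset.sum_congr rfl fun a _ => ?_
  have ha : BIJ88PolymerRep5134Gauss.ext blk X v a.1 = v a := by simp [BIJ88PolymerRep5134Gauss.ext, a.2]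
  rw [ha]
  simp only [mulVec, dotProduct, submatrix_apply]

omit [Fintype α] [DecidableEq α] [Fintype I] [DecidableEq I] in
variable {Δ} in
/-- the `X`-block of a positive definite coupling is positive definite. [cite: BalabanImbrieJaffe1988, §5.13 p.305] -/
theorem posDef_ΔX (hΔ : Δ.PosDef) (X : Finset I) :
    Matrix.PosDef (Δ.submatrix (Subtype.val : BIJ88PolymerRep5134Gauss.Site blk X → α) Subtype.val) :=
  hΔ.submatrix Subtype.val_injective

omit [DecidableEq α] [Fintype I] in
variable {Δ} in
/-- the lower form bound passes to the `X`-block. [cite: BalabanImbrieJaffe1988, §5.13 p.305] -/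
theorem formLower_ΔX {c : ℝ} (hcΔ : ∀ v, c * (v ⬝ᵥ v) ≤ v ⬝ᵥ (Δ *ᵥ v)) (X : Finset I) (v : BIJ88PolymerRep5134Gauss.Site blk X → ℝ) :
    c * (v ⬝ᵥ v) ≤ v ⬝ᵥ (Δ.submatrix Subtype.val Subtype.val *ᵥ v) := by
  rw [← dotProduct_ext blk X v v, ← quadForm_ext blk Δ X v]
  exact hcΔ _

omit [DecidableEq α] [Fintype I] in
variable {Δ} in
/-- the upper form bound passes to the `X`-block. [cite: BalabanImbrieJaffe1988, §5.13 p.305] -/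
theorem formUpper_ΔX {C : ℝ} (hCΔ : ∀ v, v ⬝ᵥ (Δ *ᵥ v) ≤ C * (v ⬝ᵥ v)) (X : Finset I) (v : BIJ88PolymerRep5134Gauss.Site blk X → ℝ) :
    v ⬝ᵥ (Δ.submatrix Subtype.val Subtype.val *ᵥ v) ≤ C * (v ⬝ᵥ v) := by
  rw [← dotProduct_ext blk X v v, ← quadForm_ext blk Δ X v]
  exact hCΔ _

/-! ## §2  Matching the two Gaussian set-ups -/

/-- **`⟨·⟩_{s,X}` is the all-fields expectation of the X-instance**: p25's region expectation
`BIJ88PolymerRep5134Gauss.expect X s` (fields on the sites of `X`, precision the `X`-block of `Δ_s`, source `ℱ|_X`,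
observable `Π_{□_i⊂X} f(□_i)`) equals p13's `BIJ88PairingDisplay305.expect` for the sites `Site blk X`, cubes `x ↦ blk x`,
coupling `Δ|_X`, source `src X`, observable `obs X`. [cite: BalabanImbrieJaffe1988, §5.13 p.306] -/
theorem expect_region_eq (X : Finset I) (s : I → ℝ) :
    BIJ88PolymerRep5134Gauss.expect blk Δ ℱ f X s
      = BIJ88PairingDisplay305.expect (fun x : BIJ88PolymerRep5134Gauss.Site blk X => blk x.1) (Δ.submatrix Subtype.val Subtype.val)
          (src blk ℱ X) (obs blk f X) s := by
  rw [BIJ88PolymerRep5134Gauss.expect, BIJ88PairingDisplay305.expect, interpForm_X]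

/-! ## §3  The seam: `Dexp = dexp` on the closed cube -/

variable {Δ} in
/-- **THE SEAM (clause C2 of row C2.Eq5.13.3-5.13.4)**: for `Δ ≻ 0` with form bounds `c‖v‖² ≤ ⟨v,Δv⟩ ≤ C‖v‖²`
(`c > 0`), bounded measurable factors `f(□_i)`, a duplicate-free coordinate list `L ⊇ Γ` and `s ∈ [0,1]^I`, p25's honest
iterated Fréchet partial `∂_Γ⟨Π_{□_i⊂X} f(□_i)⟩_{s,X}` (`Dexp L X Γ s`) EQUALS p13's Ursell family `∂Γ⟨H⟩(s)` (`dexp Γ s`)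
of the X-instance with `H = Π_{□_i⊂X} f(□_i)`.  Proof: induction on `Γ`; at `Γ = ∅` both are `⟨H⟩_s`
(`Dexp_empty`, `dexp_empty`, `expect_region_eq`); both families satisfy the FTC recursion
`d/du|_{u=s_k} D_Γ(s[k↦u]) = D_{Γ∪k}(s)` on the closed cube (`hasDerivAt_Dexp`, `hasDerivAt_dexp`), and a derivative
within `Icc 0 1` is unique (`uniqueDiffOn_Icc`). [cite: BalabanImbrieJaffe1988, §5.13 Eq. (5.13.3) p.305–306] -/
theorem Dexp_eq_dexp (hΔ : Δ.PosDef) {c C : ℝ} (hc : 0 < c) (hcΔ : ∀ v, c * (v ⬝ᵥ v) ≤ v ⬝ᵥ (Δ *ᵥ v))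
    (hCΔ : ∀ v, v ⬝ᵥ (Δ *ᵥ v) ≤ C * (v ⬝ᵥ v)) (hfm : ∀ i, Measurable (f i)) (hfb : ∀ i, ∃ K, ∀ φ, |f i φ| ≤ K)
    {L : List I} (hL : L.Nodup) (X : Finset I) {Γ : Finset I} (hΓ : ∀ i ∈ Γ, i ∈ L) {s : I → ℝ}
    (hs : ∀ i, 0 ≤ s i ∧ s i ≤ 1) :
    Dexp blk Δ ℱ f L X Γ s
      = dexp (fun x : BIJ88PolymerRep5134Gauss.Site blk X => blk x.1) (Δ.submatrix Subtype.val Subtype.val)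
          (src blk ℱ X) (obs blk f X) Γ s := by
  have hHm : AEStronglyMeasurable (obs blk f X) volume := (obs_measurable blk hfm X).aestronglyMeasurable
  obtain ⟨K₀, hK⟩ := obs_bdd blk hfb X
  induction Γ using Finset.induction_on generalizing s with
  | empty => rw [Dexp_empty, dexp_empty, expect_region_eq]
  | @insert k Γ hk ih =>
      have hkL : k ∈ L := hΓ k (mem_insert_self _ _)
      have hΓL : ∀ i ∈ Γ, i ∈ L := fun i hi => hΓ i (mem_insert_of_mem hi)
      have h1 := hasDerivAt_Dexp blk Δ ℱ f hΔ hfm hfb hL X hkL hk hs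
      have h2 := hasDerivAt_dexp (fun x : BIJ88PolymerRep5134Gauss.Site blk X => blk x.1) (posDef_ΔX blk hΔ X) hc
        (formLower_ΔX blk hcΔ X)
        (formUpper_ΔX blk hCΔ X) hs k (src blk ℱ X) hHm hK (Γ := Γ) hk
      have hud : UniqueDiffWithinAt ℝ (Icc (0:ℝ) 1) (s k) := uniqueDiffOn_Icc zero_lt_one _ ⟨(hs k).1, (hs k).2⟩
      refine hud.eq_deriv _ h1.hasDerivWithinAt (h2.hasDerivWithinAt.congr_of_mem ?_ ⟨(hs k).1, (hs k).2⟩)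
      intro u hu
      exact ih hΓL (update_mem_cube hs k ⟨hu.1, hu.2⟩)

/-! ## §4  (5.13.3) as printed: the integrated equation for the region expectations -/

variable {Δ} in
/-- **DISPLAY (5.13.3), THE INTEGRATED EQUATION, IN THE CORRECTED FORM OF G-C2-24, FOR THE GAUSSIAN EXPECTATIONS OF A
REGION `X`** (*«⟨Π_{i∈I} f(□_i)⟩_1 = Σ_{Γ⊂I} ∫ds_Γ Σ_{π∈𝒫(Γ)} ⟨Π_{α∈π}[Σ_{ω(α)} ⟨δ/δΦ, C_s□_{i₁}Δ□_{i₂}C_s … C_s(½δ/δΦ + ℱ)⟩]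
Π_{i∈I} f(□_i)⟩_{s_Γ}», «⟨·⟩_{s_Γ,X} is defined by integrating over the fields in X only»*): for `Δ ≻ 0` with form bounds,
bounded measurable factors whose product `Π_{□_i⊂X} f(□_i)` lies in a smooth class `𝒞` on the fields of `X`
(closed under directional derivatives, `C¹`-bounded), and a base colouring `z₀` (any map `Finset I → Site blk X`; one
exists as soon as `X` has a site),
`⟨Π_{□_i⊂X} f(□_i)⟩_{1,X} = Σ_{Γ⊂I} ∫ds_Γ Σ_{σ∈smallParts Γ} (−1)^{|σ|} Σ_{P∈setPartitions σ} ⟨(Π_{c∈P} 𝕋_c) Π_{□_i⊂X} f(□_i)⟩_{s_Γ,X}`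
(`s_i = 0` off `Γ`), `𝕋_c = ∂_{C_s𝔫(c)ℱ} + ½Σ_{pq}(C_s𝔫(c))_{pq}∂_p∂_q`, `C_s = (prec X s)⁻¹`, `N_b = M_b(s) + M_b(s)ᵀ` — the
composition `ftc_expansion_gauss` ∘ `Dexp_eq_dexp` ∘ `dexp_eq_sum_trains`; the print's `Π_{α∈π}` is the pair (`σ`, `P`)
and the vertices `□Δ□` are the corrected vertices `N_b`. [cite: BalabanImbrieJaffe1988, §5.13 Eq. (5.13.3) p.306] -/
theorem expect_one_eq_expansionSum_trains (hΔ : Δ.PosDef) {c C : ℝ} (hc : 0 < c)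
    (hcΔ : ∀ v, c * (v ⬝ᵥ v) ≤ v ⬝ᵥ (Δ *ᵥ v)) (hCΔ : ∀ v, v ⬝ᵥ (Δ *ᵥ v) ≤ C * (v ⬝ᵥ v))
    (hfm : ∀ i, Measurable (f i)) (hfb : ∀ i, ∃ K, ∀ φ, |f i φ| ≤ K) (X : Finset I)
    (𝒞 : ((BIJ88PolymerRep5134Gauss.Site blk X → ℝ) → ℝ) → Prop)
    (hC : ∀ G, 𝒞 G → ContDiff ℝ 1 G ∧ (∃ K₀ : ℝ, ∀ φ, ‖G φ‖ ≤ K₀) ∧ ∃ K₁ : ℝ, ∀ φ, ‖fderiv ℝ G φ‖ ≤ K₁)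
    (hD : ∀ G (u : BIJ88PolymerRep5134Gauss.Site blk X → ℝ), 𝒞 G → 𝒞 (fun φ => fderiv ℝ G φ u)) (hH : 𝒞 (obs blk f X))
    (z₀ : Finset I → BIJ88PolymerRep5134Gauss.Site blk X) :
    BIJ88PolymerRep5134Gauss.expect blk Δ ℱ f X (fun _ => 1)
      = expansionSum (univ : Finset I).toList
          (fun Γ s => ∑ σ ∈ smallParts Γ, (-1 : ℝ) ^ σ.card *
            ∑ P ∈ setPartitions σ, gexp (prec blk Δ X s) (src blk ℱ X)
              (trains (src blk ℱ X) (prec blk Δ X s)⁻¹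
                (fun b => bmat (fun x : BIJ88PolymerRep5134Gauss.Site blk X => blk x.1) (Δ.submatrix Subtype.val Subtype.val) s b
                  + (bmat (fun x : BIJ88PolymerRep5134Gauss.Site blk X => blk x.1) (Δ.submatrix Subtype.val Subtype.val) s b)ᵀ)
                P.toList (obs blk f X))) 0 := by
  rw [ftc_expansion_gauss blk Δ ℱ f hΔ hfm hfb X]
  refine expansionSum_congr_cube (fun Γ σ hσ => ?_) _ fun _ => ⟨le_rfl, zero_le_one⟩
  rw [Dexp_eq_dexp blk ℱ f hΔ hc hcΔ hCΔ hfm hfb (nodup_toList _) X (fun i _ => mem_toList.2 (mem_univ i)) hσ,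
    dexp_eq_sum_trains (fun x : BIJ88PolymerRep5134Gauss.Site blk X => blk x.1) (posDef_ΔX blk hΔ X) hc (formLower_ΔX blk hcΔ X)
      (formUpper_ΔX blk hCΔ X) hσ (src blk ℱ X) 𝒞 hC hD hH z₀ Γ, interpForm_X]

/-! ## §5  (5.13.3) integrated, for factors in `C_b^∞` (clause C3 instantiated; v1.1) -/

variable {Δ} in
/-- **DISPLAY (5.13.3), INTEGRATED, CORRECTED FORM (G-C2-24), FOR THE GAUSSIAN EXPECTATIONS OF A REGION — WITH THE
CONCRETE SMOOTH CLASS `C_b^∞`**: for `Δ ≻ 0` with form bounds `c‖v‖² ≤ ⟨v,Δv⟩ ≤ C‖v‖²` (`c > 0`), factors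
`f(□_i) ∈ C_b^∞` (smooth in the fields with every derivative bounded, `BIJ88SmoothFactors5133.CbInf`) and a region `X`
with at least one site,
`⟨Π_{□_i⊂X} f(□_i)⟩_{1,X} = Σ_{Γ⊂I} ∫ds_Γ Σ_{σ∈smallParts Γ} (−1)^{|σ|} Σ_{P∈setPartitions σ} ⟨(Π_{c∈P} 𝕋_c) Π_{□_i⊂X} f(□_i)⟩_{s_Γ,X}`
— `expect_one_eq_expansionSum_trains` with `𝒞 := CbInf` (`CbInf.nice` = hC, `CbInf.fderiv_apply` = hD,
`CbInf.obs` = hH, `CbInf.measurable`/`CbInf.bdd` = hfm/hfb). [cite: BalabanImbrieJaffe1988, §5.13 Eq. (5.13.3) p.306] -/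
theorem expect_one_eq_expansionSum_trains_of_cbInf (hΔ : Δ.PosDef) {c C : ℝ} (hc : 0 < c)
    (hcΔ : ∀ v, c * (v ⬝ᵥ v) ≤ v ⬝ᵥ (Δ *ᵥ v)) (hCΔ : ∀ v, v ⬝ᵥ (Δ *ᵥ v) ≤ C * (v ⬝ᵥ v))
    (hf : ∀ i, CbInf (f i)) (X : Finset I) (hX : ∃ x, blk x ∈ X) :
    BIJ88PolymerRep5134Gauss.expect blk Δ ℱ f X (fun _ => 1)
      = expansionSum (univ : Finset I).toList
          (fun Γ s => ∑ σ ∈ smallParts Γ, (-1 : ℝ) ^ σ.card *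
            ∑ P ∈ setPartitions σ, gexp (prec blk Δ X s) (src blk ℱ X)
              (trains (src blk ℱ X) (prec blk Δ X s)⁻¹
                (fun b => bmat (fun x : BIJ88PolymerRep5134Gauss.Site blk X => blk x.1) (Δ.submatrix Subtype.val Subtype.val) s b
                  + (bmat (fun x : BIJ88PolymerRep5134Gauss.Site blk X => blk x.1) (Δ.submatrix Subtype.val Subtype.val) s b)ᵀ)
                P.toList (obs blk f X))) 0 := by
  obtain ⟨x, hx⟩ := hX
  exact expect_one_eq_expansionSum_trains blk ℱ f hΔ hc hcΔ hCΔ (fun i => (hf i).measurable) (fun i => (hf i).bdd) X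
    CbInf (fun G hG => hG.nice) (fun G u hG => hG.fderiv_apply u) (CbInf.obs blk f X fun i _ => hf i) fun _ => ⟨x, hx⟩

end Literature.MathematicalPhysics.QuantumFieldTheory.BalabanImbrieJaffe1984to88.BIJ88WalkFormIntegrated5133

end
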